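import Summits.CriticalPhenomena.PercolationContinuityZ3.Theorems.Transplant.SkelNegBParamsRootValsY
import Summits.CriticalPhenomena.PercolationContinuityZ3.Theorems.Transplant.SkelNegBParamsResiduals2
import HarnessLib

/-!
# N1 params, chain of record `NegB`, part RootCrossY: THE y′-LEG's SIGN, CLEARANCE, CROSS LINK AND REACH AT THE LEDGER — `KS.σuOf σ'` (p3's
# `σu := sgOf du · sgn⁺ v_L`), **`hclrY_R`** (every y′-region clears the root on the `σu` side), **`hx₂₃_R`** (the x-prefix's core `4` feeds the y′-run's
# core `0`: start half-width `qY = W + 4RA′ + 3`, window centred by the `σ'·v_L` shift), **`hπ3_R`** (the y′-regions' `ℓ¹` reach `≤ exR2`)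

builds on p205010 (kernel theorem, internal audit signed; external expert review pending) — nothing in this file uses p205010; NOTHING is claimed about
the node `SamePDropOfSkeletonNeg₁` (OPEN).
Lane `prim-bschramm-*`, seat `prim-bschramm-stmt` (gen 14); helper file (`--supports stmt-CriticalPhenomena-4575 --as helper`); ledger HOME/prim-bschramm-stmt/NEG-PARAMS.md v0.13.
[cite: KozmaNitzan2024, §4 p. 28 ((32) at the root), Lemma 11 (p. 22)] [cite: MartineauTassion2017, §3.2, §4.3 Lemma 4.2]
-/

noncomputable section

open scoped Classical

namespace Summit.CriticalPhenomena.PercolationContinuityZ3.Theorems.Transplant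

namespace PlanarSkeletonNeg

namespace NegB

open Literature.Probability.Percolation Literature.Probability.LatticeModels SimpleGraph
open SkelConc (Consts)
open Skelφ (shearUnit shearUnit_pos yRunSched yPrmW xRunSched xPrmW)
open Skelφ.StepI (DataN)
open TwoAxis.Para (modulus)
open Neg

namespace KS

section Cross

variable (κ : Consts) {V : Type} [DecidableEq V] [Countable V] {G : SimpleGraph V} [G.LocallyFinite] (Φ : PlanarSkeletonNeg G) (t : V)
  (p : unitInterval) (D : DataN V) (g f mk : ℕ)

/-- **The root-side sign of the y-family** `σu := σ'·sgn⁺(v_L)` (so that `σu·σ'·v_L = |v_L|`). [this work] -/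
def σuOf (σ' : ℤ) : ℤ := σ' * (if 0 ≤ vL κ Φ t p D g f then 1 else -1)

/-- `σu = ±1`. [folklore] -/
theorem σuOf_cases {σ' : ℤ} (hσ : σ' = 1 ∨ σ' = -1) : σuOf κ Φ t p D g f σ' = 1 ∨ σuOf κ Φ t p D g f σ' = -1 := by
  unfold σuOf; rcases hσ with rfl | rfl <;> split_ifs <;> simp

/-- `σu·σ'·v_L = |v_L|`. [folklore] -/
theorem σuOf_sign {σ' : ℤ} (hσ : σ' = 1 ∨ σ' = -1) : σuOf κ Φ t p D g f σ' * σ' * vL κ Φ t p D g f = |vL κ Φ t p D g f| := by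
  have hσ2 : σ' * σ' = 1 := by rcases hσ with rfl | rfl <;> norm_num
  unfold σuOf
  split_ifs with h
  · rw [abs_of_nonneg h]; linear_combination (vL κ Φ t p D g f) * hσ2
  · push Not at h; rw [abs_of_neg h]; linear_combination (-(vL κ Φ t p D g f)) * hσ2

/-- **`hclrY`**: every y′-region (transverse range `[bLo k − RA′ − n_L, bHi k + RA′ + n_L]`) lies on the `σu` side of the root beyond abscissa `k`, for the origin
`yY := yYof σu σ' yX`, whenever `σu·σ'·v_L = |v_L|` and `k < σu·yX₀ + n_L`. [folklore] -/
theorem hclrY_R (hv : |vL κ Φ t p D g f| ≤ (nL κ Φ t p D g f : ℤ)) (hRAn : 2000 * (RA' κ Φ t p D mk + 2) ≤ nL κ Φ t p D g f)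
    {σu σ' : ℤ} (hσu : σu = 1 ∨ σu = -1) (hσ : σ' = 1 ∨ σ' = -1) (hs : σu * σ' * vL κ Φ t p D g f = |vL κ Φ t p D g f|)
    (yX : Site 2) (hx0 : (D.k : ℤ) < σu * yX 0 + nL κ Φ t p D g f) (qY' Ny : ℕ) (hNy : Ny + 1 ≤ 1000) :
    ∀ k ≤ Ny, ∀ b : ℤ, (yPrmW (nL κ Φ t p D g f) (ℓL κ Φ t p D g f) (hL κ Φ t p D g f) (vL κ Φ t p D g f) (RA' κ Φ t p D mk) qY' Ny).bLo k - RA' κ Φ t p D mk - nL κ Φ t p D g f ≤ b →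
      b ≤ (yPrmW (nL κ Φ t p D g f) (ℓL κ Φ t p D g f) (hL κ Φ t p D g f) (vL κ Φ t p D g f) (RA' κ Φ t p D mk) qY' Ny).bHi k + RA' κ Φ t p D mk + nL κ Φ t p D g f →
        (D.k : ℤ) < σu * σ' * b + σu * yYof κ Φ t p D g f σu σ' yX 0 := by
  intro k hk b hb1 hb2
  unfold ChainPara.RunPrm.bLo at hb1
  unfold ChainPara.RunPrm.bHi at hb2
  simp only [Skelφ.yPrmW] at hb1 hb2
  obtain ⟨hv1, hv2⟩ := abs_le.1 hv
  rw [Int.toNat_of_nonneg (by linarith)] at hb1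
  rw [Int.toNat_of_nonneg (by linarith)] at hb2
  have hk' : (k : ℤ) ≤ 999 := by
    have : ((k : ℕ) : ℤ) ≤ Ny := by exact_mod_cast hk
    have : ((Ny : ℕ) : ℤ) + 1 ≤ 1000 := by exact_mod_cast hNy
    linarith
  have hk0 : (0 : ℤ) ≤ k := Nat.cast_nonneg _
  have hR0 : (0 : ℤ) ≤ (RA' κ Φ t p D mk : ℤ) := Nat.cast_nonneg _
  have hRAn' : 2000 * ((RA' κ Φ t p D mk : ℤ) + 2) ≤ (nL κ Φ t p D g f : ℤ) := by exact_mod_cast hRAn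
  have hσu2 : σu * σu = 1 := by rcases hσu with rfl | rfl <;> norm_num
  have e0 : σu * yYof κ Φ t p D g f σu σ' yX 0 = σu * yX 0 + 4 * (nL κ Φ t p D g f : ℤ) + σu * σ' * vL κ Φ t p D g f := by
    unfold yYof Δ0; simp only [Pi.add_apply, Skelφ.pt_zero]; linear_combination (4 * (nL κ Φ t p D g f : ℤ)) * hσu2
  rw [e0, hs]
  have hsv : σu * σ' = 1 ∨ σu * σ' = -1 := by
    rcases hσu with rfl | rfl <;> rcases hσ with rfl | rfl <;> norm_num
  have hkR : (k : ℤ) * (RA' κ Φ t p D mk : ℤ) ≤ 999 * (RA' κ Φ t p D mk : ℤ) := mul_le_mul_of_nonneg_right hk' hR0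
  have hkR0 : (0 : ℤ) ≤ (k : ℤ) * (RA' κ Φ t p D mk : ℤ) := mul_nonneg hk0 hR0
  rcases hsv with h1 | h1
  · have hvs : σu * σ' * vL κ Φ t p D g f = vL κ Φ t p D g f := by rw [h1, one_mul]
    rw [hvs] at hs
    rw [h1, one_mul]
    have hv0 : 0 ≤ vL κ Φ t p D g f := by rw [hs]; exact abs_nonneg _
    have hkv : (0 : ℤ) ≤ (k : ℤ) * vL κ Φ t p D g f := mul_nonneg hk0 hv0
    rw [← hs]
    linarith
  · have hvs : σu * σ' * vL κ Φ t p D g f = -vL κ Φ t p D g f := by rw [h1]; ring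
    rw [hvs] at hs
    rw [h1]
    have hv0 : vL κ Φ t p D g f ≤ 0 := by linarith [abs_nonneg (vL κ Φ t p D g f)]
    have hkv : (k : ℤ) * vL κ Φ t p D g f ≤ 0 := mul_nonpos_of_nonneg_of_nonpos hk0 hv0
    rw [← hs]
    linarith

/-- **`hx₂₃`**: the x-prefix's core `4` (start half-width `qX`, `4qX ≤ n_L`) is carried into the y′-run's core `0` (start half-width `KS.qY = W + 4RA′ + 3`)
by the change of origin `yY := yX + (Δ0, Δ1)`. [folklore] -/
theorem hx₂₃_R (hn : 1 ≤ nL κ Φ t p D g f) (hv : |vL κ Φ t p D g f| ≤ (nL κ Φ t p D g f : ℤ))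
    (hlay : ((nL κ Φ t p D g f + (hL κ Φ t p D g f).natAbs : ℕ) : ℤ) ≤ (nL κ Φ t p D g f : ℤ) * ℓL κ Φ t p D g f + 1) (hRAn : 2000 * (RA' κ Φ t p D mk + 2) ≤ nL κ Φ t p D g f)
    {σu σ' : ℤ} (hσu : σu = 1 ∨ σu = -1) (hσ : σ' = 1 ∨ σ' = -1) (yX : Site 2) (qX : ℕ) (hq : 4 * qX ≤ nL κ Φ t p D g f) (Ny : ℕ) :
    ∀ r : Site 2, Skelφ.pt (r 0 - σu * yX 0) ((σu * ((nL κ Φ t p D g f : ℤ) * (r 1 - yX 1) - hL κ Φ t p D g f * (σu * r 0 - yX 0))) / (shearUnit (nL κ Φ t p D g f) (hL κ Φ t p D g f) : ℤ)) ∈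
        (xRunSched (nL κ Φ t p D g f) (ℓL κ Φ t p D g f) (hL κ Φ t p D g f) (RA' κ Φ t p D mk) qX 3).core (3 + 1) →
      Skelφ.pt ((σ' * ((nL κ Φ t p D g f : ℤ) * (r 1 - yYof κ Φ t p D g f σu σ' yX 1) - hL κ Φ t p D g f * (σu * r 0 - yYof κ Φ t p D g f σu σ' yX 0))) / (shearUnit (nL κ Φ t p D g f) (hL κ Φ t p D g f) : ℤ))
        (σ' * (σu * r 0 - yYof κ Φ t p D g f σu σ' yX 0)) ∈
        (yRunSched hn hv hlay (RA' κ Φ t p D mk) (qY κ Φ t p D g f mk) Ny).core 0 := by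
  intro r hr
  rw [Skelφ.xRunSched, Skelφ.mem_scheduleN_core_iff] at hr
  rw [Skelφ.yRunSched, Skelφ.mem_scheduleN_core_iff]
  unfold ChainPara.RunPrm.InCore ChainPara.RunPrm.aLo ChainPara.RunPrm.aHi ChainPara.RunPrm.bLo ChainPara.RunPrm.bHi at hr ⊢
  simp only [Skelφ.xPrmW, Skelφ.yPrmW, Skelφ.pt_zero, Skelφ.pt_one, Nat.cast_add, Nat.cast_one, Nat.cast_ofNat, mul_zero, zero_sub,
    zero_add, Nat.cast_zero, zero_mul, sub_zero] at hr ⊢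
  obtain ⟨hv1, hv2⟩ := abs_le.1 hv
  rw [Int.toNat_of_nonneg (by linarith), Int.toNat_of_nonneg (by linarith)]
  have hU := shearUnit_pos hn (hL κ Φ t p D g f)
  have hUn : (nL κ Φ t p D g f : ℤ) ≤ (shearUnit (nL κ Φ t p D g f) (hL κ Φ t p D g f) : ℤ) := by unfold Skelφ.shearUnit; push_cast; linarith [abs_nonneg (hL κ Φ t p D g f), Int.natCast_natAbs (hL κ Φ t p D g f)]
  have hσu2 : σu * σu = 1 := by rcases hσu with rfl | rfl <;> norm_num
  have hσ2 : σ' * σ' = 1 := by rcases hσ with rfl | rfl <;> norm_num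
  have hq' : 4 * (qX : ℤ) ≤ nL κ Φ t p D g f := by exact_mod_cast hq
  have hR4 : 16 * (RA' κ Φ t p D mk : ℤ) ≤ nL κ Φ t p D g f := by
    have : ((2000 * (RA' κ Φ t p D mk + 2) : ℕ) : ℤ) ≤ nL κ Φ t p D g f := by exact_mod_cast hRAn
    push_cast at this; linarith
  obtain ⟨ha1, ha2, hb1, hb2⟩ := hr
  set a := r 0 - σu * yX 0 with ha
  set βx := (nL κ Φ t p D g f : ℤ) * (r 1 - yX 1) - hL κ Φ t p D g f * (σu * r 0 - yX 0) with hβx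
  obtain ⟨f1, f2⟩ := RootArith.floor_sandwich (x := σu * βx) hU
  obtain ⟨r1, r2⟩ := ρY_bounds κ Φ t p D g f hn σu σ'
  have et : σ' * (σu * r 0 - yYof κ Φ t p D g f σu σ' yX 0) = σ' * σu * (a - 4 * (nL κ Φ t p D g f : ℤ)) - vL κ Φ t p D g f := by
    unfold yYof Δ0; simp only [Pi.add_apply, Skelφ.pt_zero]; rw [ha]
    linear_combination (σ' * yX 0) * hσu2 - vL κ Φ t p D g f * hσ2
  have eb : (nL κ Φ t p D g f : ℤ) * (r 1 - yYof κ Φ t p D g f σu σ' yX 1) - hL κ Φ t p D g f * (σu * r 0 - yYof κ Φ t p D g f σu σ' yX 0) = βx + ρY κ Φ t p D g f σu σ' := by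
    unfold yYof ρY Δ1; simp only [Pi.add_apply, Skelφ.pt_zero, Skelφ.pt_one]; rw [hβx]; ring
  rw [et, eb]
  norm_num at ha1 ha2 hb1 hb2
  have hst : |σ' * σu * (a - 4 * (nL κ Φ t p D g f : ℤ))| ≤ (qX : ℤ) + 4 * (RA' κ Φ t p D mk : ℤ) := by
    have h1 : |σ' * σu| = 1 := by
      rcases hσu with rfl | rfl <;> rcases hσ with rfl | rfl <;> norm_num
    have h2 : |a - 4 * (nL κ Φ t p D g f : ℤ)| ≤ (qX : ℤ) + 4 * (RA' κ Φ t p D mk : ℤ) := abs_le.2 ⟨by linarith, by linarith⟩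
    calc |σ' * σu * (a - 4 * (nL κ Φ t p D g f : ℤ))| = |σ' * σu| * |a - 4 * (nL κ Φ t p D g f : ℤ)| := abs_mul _ _
      _ ≤ _ := by rw [h1, one_mul]; exact h2
  obtain ⟨t1, t2⟩ := abs_le.1 hst
  have hβ : |βx| ≤ (shearUnit (nL κ Φ t p D g f) (hL κ Φ t p D g f) : ℤ) * ((Wrun κ Φ t p D g f : ℤ) + 4 * (RA' κ Φ t p D mk : ℤ) + 1) := by
    have hσa : |σu| = 1 := by rcases hσu with rfl | rfl <;> norm_num
    have e : |βx| = |σu * βx| := by rw [abs_mul, hσa, one_mul]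
    rw [e, abs_le]
    unfold Wrun; push_cast
    have l1 := mul_le_mul_of_nonneg_left hb1 hU.le
    have l2 := mul_le_mul_of_nonneg_left hb2 hU.le
    constructor <;> nlinarith
  obtain ⟨q1, q2⟩ := abs_le.1 hβ
  obtain ⟨g1, g2⟩ := RootArith.floor_sandwich (x := σ' * (βx + ρY κ Φ t p D g f σu σ')) hU
  have hρn : ρY κ Φ t p D g f σu σ' < (shearUnit (nL κ Φ t p D g f) (hL κ Φ t p D g f) : ℤ) := by have : ρY κ Φ t p D g f σu σ' < nL κ Φ t p D g f := r2; linarith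
  have hσb : |σ' * (βx + ρY κ Φ t p D g f σu σ')| ≤ (shearUnit (nL κ Φ t p D g f) (hL κ Φ t p D g f) : ℤ) * ((Wrun κ Φ t p D g f : ℤ) + 4 * (RA' κ Φ t p D mk : ℤ) + 1) + (shearUnit (nL κ Φ t p D g f) (hL κ Φ t p D g f) : ℤ) := by
    have hσa : |σ'| = 1 := by rcases hσ with rfl | rfl <;> norm_num
    rw [abs_mul, hσa, one_mul]
    calc |βx + ρY κ Φ t p D g f σu σ'| ≤ |βx| + |ρY κ Φ t p D g f σu σ'| := abs_add_le _ _
      _ ≤ _ := by rw [abs_of_nonneg r1]; linarith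
  obtain ⟨s1, s2⟩ := abs_le.1 hσb
  refine ⟨?_, ?_, by linarith, by linarith⟩
  · unfold qY; push_cast
    by_contra hc; push Not at hc
    have h1 : (shearUnit (nL κ Φ t p D g f) (hL κ Φ t p D g f) : ℤ) * (σ' * (βx + ρY κ Φ t p D g f σu σ') / (shearUnit (nL κ Φ t p D g f) (hL κ Φ t p D g f) : ℤ)) ≤ (shearUnit (nL κ Φ t p D g f) (hL κ Φ t p D g f) : ℤ) * (-((Wrun κ Φ t p D g f : ℤ) + 4 * (RA' κ Φ t p D mk : ℤ) + 3) - 1) :=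
      mul_le_mul_of_nonneg_left (by linarith) hU.le
    linarith
  · unfold qY; push_cast
    by_contra hc; push Not at hc
    have h1 : (shearUnit (nL κ Φ t p D g f) (hL κ Φ t p D g f) : ℤ) * ((Wrun κ Φ t p D g f : ℤ) + 4 * (RA' κ Φ t p D mk : ℤ) + 3 + 1) ≤ (shearUnit (nL κ Φ t p D g f) (hL κ Φ t p D g f) : ℤ) * (σ' * (βx + ρY κ Φ t p D g f σu σ') / (shearUnit (nL κ Φ t p D g f) (hL κ Φ t p D g f) : ℤ)) :=
      mul_le_mul_of_nonneg_left (by linarith) hU.le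
    linarith

/-- **`hπ3`**: the y′-regions' `ℓ¹` reach is at most `exR2`, for any origin with `|yY|₁ ≤ Yb + 55 n_L` (parts RootValsY `yYof_l1`, Residuals `yL_l1`).
[folklore] -/
theorem hπ3_R (hn : 1 ≤ nL κ Φ t p D g f) (hv : |vL κ Φ t p D g f| ≤ (nL κ Φ t p D g f : ℤ)) (hκ : (hL κ Φ t p D g f).natAbs ≤ 10 * nL κ Φ t p D g f)
    (hlay : ((nL κ Φ t p D g f + (hL κ Φ t p D g f).natAbs : ℕ) : ℤ) ≤ (nL κ Φ t p D g f : ℤ) * ℓL κ Φ t p D g f + 1)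
    (yY : Site 2) (hyY : (yY 0).natAbs + (yY 1).natAbs ≤ Yb κ Φ t p D g f + 55 * nL κ Φ t p D g f) (qY' Ny : ℕ) (hNy : Ny + 1 ≤ 1000) :
    ∀ k ≤ Ny, (yY 0).natAbs + (yY 1).natAbs + (((((k + 1 : ℕ) : ℤ) * vL κ Φ t p D g f).natAbs +
      (((shearUnit (nL κ Φ t p D g f) (hL κ Φ t p D g f) : ℤ) * |((k + 1 : ℕ) : ℤ) * (yPrmW (nL κ Φ t p D g f) (ℓL κ Φ t p D g f) (hL κ Φ t p D g f) (vL κ Φ t p D g f) (RA' κ Φ t p D mk) qY' Ny).sLo| +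
        |hL κ Φ t p D g f| * |((k + 1 : ℕ) : ℤ) * vL κ Φ t p D g f| + shearUnit (nL κ Φ t p D g f) (hL κ Φ t p D g f)) / nL κ Φ t p D g f).natAbs + 1)) ≤ exR2 κ Φ t p D g f := by
  intro k hk
  have hU := shearUnit_pos hn (hL κ Φ t p D g f)
  have hn0 : (0 : ℤ) < nL κ Φ t p D g f := by exact_mod_cast hn
  have hk1 : ((k + 1 : ℕ) : ℤ) ≤ 1000 := by
    have : ((k : ℕ) : ℤ) ≤ Ny := by exact_mod_cast hk
    have : ((Ny : ℕ) : ℤ) + 1 ≤ 1000 := by exact_mod_cast hNy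
    push_cast; linarith
  have hk0 : (0 : ℤ) ≤ ((k + 1 : ℕ) : ℤ) := Nat.cast_nonneg _
  have hκ' : |hL κ Φ t p D g f| ≤ 10 * (nL κ Φ t p D g f : ℤ) := by rw [← Int.natCast_natAbs]; exact_mod_cast hκ
  have hUe : (shearUnit (nL κ Φ t p D g f) (hL κ Φ t p D g f) : ℤ) = (nL κ Φ t p D g f : ℤ) + |hL κ Φ t p D g f| := by unfold Skelφ.shearUnit; push_cast [Int.natCast_natAbs]; rfl
  have hU11 : (shearUnit (nL κ Φ t p D g f) (hL κ Φ t p D g f) : ℤ) ≤ 11 * (nL κ Φ t p D g f : ℤ) := by rw [hUe]; linarith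
  have hlay' : (shearUnit (nL κ Φ t p D g f) (hL κ Φ t p D g f) : ℤ) ≤ (nL κ Φ t p D g f : ℤ) * ℓL κ Φ t p D g f + 1 := by
    have : ((nL κ Φ t p D g f + (hL κ Φ t p D g f).natAbs : ℕ) : ℤ) = (shearUnit (nL κ Φ t p D g f) (hL κ Φ t p D g f) : ℤ) := by unfold Skelφ.shearUnit; rfl
    rw [← this]; exact hlay
  have hsLo : (yPrmW (nL κ Φ t p D g f) (ℓL κ Φ t p D g f) (hL κ Φ t p D g f) (vL κ Φ t p D g f) (RA' κ Φ t p D mk) qY' Ny).sLo = sLoY κ Φ t p D g f := rfl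
  rw [hsLo]
  have sL' : (shearUnit (nL κ Φ t p D g f) (hL κ Φ t p D g f) : ℤ) * sLoY κ Φ t p D g f ≤ (nL κ Φ t p D g f : ℤ) * ℓL κ Φ t p D g f - (shearUnit (nL κ Φ t p D g f) (hL κ Φ t p D g f) : ℤ) + 1 := by unfold sLoY; exact Int.mul_ediv_self_le hU.ne'
  have hs0 : 0 ≤ sLoY κ Φ t p D g f := by unfold sLoY; exact Int.ediv_nonneg (by linarith) hU.le
  generalize ((k + 1 : ℕ) : ℤ) = K at hk1 hk0 ⊢
  have a1 : |K * vL κ Φ t p D g f| ≤ 1000 * (nL κ Φ t p D g f : ℤ) := by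
    rw [abs_mul, abs_of_nonneg hk0]; exact mul_le_mul hk1 hv (abs_nonneg _) (by norm_num)
  have a2 : (shearUnit (nL κ Φ t p D g f) (hL κ Φ t p D g f) : ℤ) * |K * sLoY κ Φ t p D g f| ≤ 1000 * ((nL κ Φ t p D g f : ℤ) * ℓL κ Φ t p D g f) := by
    rw [abs_of_nonneg (mul_nonneg hk0 hs0)]
    have e : (shearUnit (nL κ Φ t p D g f) (hL κ Φ t p D g f) : ℤ) * (K * sLoY κ Φ t p D g f) = K * ((shearUnit (nL κ Φ t p D g f) (hL κ Φ t p D g f) : ℤ) * sLoY κ Φ t p D g f) := by ring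
    rw [e]
    have h1 : K * ((shearUnit (nL κ Φ t p D g f) (hL κ Φ t p D g f) : ℤ) * sLoY κ Φ t p D g f) ≤ K * ((nL κ Φ t p D g f : ℤ) * ℓL κ Φ t p D g f) := mul_le_mul_of_nonneg_left (by linarith) hk0
    have hnl : (0 : ℤ) ≤ (nL κ Φ t p D g f : ℤ) * ℓL κ Φ t p D g f := by nlinarith
    have h2 : K * ((nL κ Φ t p D g f : ℤ) * ℓL κ Φ t p D g f) ≤ 1000 * ((nL κ Φ t p D g f : ℤ) * ℓL κ Φ t p D g f) := mul_le_mul_of_nonneg_right hk1 hnl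
    linarith
  have a3 : |hL κ Φ t p D g f| * |K * vL κ Φ t p D g f| ≤ 10 * (nL κ Φ t p D g f : ℤ) * (1000 * (nL κ Φ t p D g f : ℤ)) := mul_le_mul hκ' a1 (abs_nonneg _) (by positivity)
  set Nn := (shearUnit (nL κ Φ t p D g f) (hL κ Φ t p D g f) : ℤ) * |K * sLoY κ Φ t p D g f| + |hL κ Φ t p D g f| * |K * vL κ Φ t p D g f| + (shearUnit (nL κ Φ t p D g f) (hL κ Φ t p D g f) : ℤ) with hNn
  have hNn0 : 0 ≤ Nn := by rw [hNn]; positivity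
  have hNn1 : Nn ≤ (nL κ Φ t p D g f : ℤ) * (1000 * (ℓL κ Φ t p D g f : ℤ) + 10000 * (nL κ Φ t p D g f : ℤ) + 11) := by rw [hNn]; nlinarith
  have hdiv : Nn / (nL κ Φ t p D g f : ℤ) ≤ 1000 * (ℓL κ Φ t p D g f : ℤ) + 10000 * (nL κ Φ t p D g f : ℤ) + 11 := by
    have := Int.ediv_le_ediv hn0 hNn1
    rwa [Int.mul_ediv_cancel_left _ hn0.ne'] at this
  have hdiv0 : 0 ≤ Nn / (nL κ Φ t p D g f : ℤ) := Int.ediv_nonneg hNn0 hn0.le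
  have hex := (exR_le_exR2 κ Φ t p D g f).2
  have goalZ : (((yY 0).natAbs + (yY 1).natAbs + ((K * vL κ Φ t p D g f).natAbs + (Nn / (nL κ Φ t p D g f : ℤ)).natAbs + 1) : ℕ) : ℤ) ≤ (exR2 κ Φ t p D g f : ℤ) := by
    have hy : (((yY 0).natAbs + (yY 1).natAbs : ℕ) : ℤ) ≤ ((Yb κ Φ t p D g f + 55 * nL κ Φ t p D g f : ℕ) : ℤ) := by exact_mod_cast hyY
    have hex' : ((Yb κ Φ t p D g f + 11055 * nL κ Φ t p D g f + 1000 * ℓL κ Φ t p D g f + 20 : ℕ) : ℤ) ≤ (exR2 κ Φ t p D g f : ℤ) := by exact_mod_cast hex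
    push_cast [Int.natCast_natAbs] at hy hex' ⊢
    rw [abs_of_nonneg hdiv0]
    obtain ⟨a11, a12⟩ := abs_le.1 a1
    have : |K * vL κ Φ t p D g f| ≤ 1000 * (nL κ Φ t p D g f : ℤ) := a1
    linarith
  exact_mod_cast goalZ

end Cross

end KS

end NegB

end PlanarSkeletonNeg

end Summit.CriticalPhenomena.PercolationContinuityZ3.Theorems.Transplant
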